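import Summits.ResolutionOfSingularities.ResolutionOfSingularities.Theorems.RestrictCutKernels2
import HarnessLib

/-!
# RestrictCutCells — decomp-res node «RestrictCut» (lens-4 g34, critic row 194 CLEARED (NP-R) DECIDED +1 · MAP 0),
tree file 3/4 of the node

Content VERBATIM from the decomp-res lens-4 g34 node `HOME/decomp-res-lens-4/g34/RestrictCut.lean` (pin bc9b1075; no
carry, imports the landed tree only); HOME = run/shared/lean/pub/decomp-res; critic row 194 CLEARED (NP-R) DECIDED
+1 · MAP 0; landing orders INBOX :1128/:1135 — provenance, critic text and the lens header in full in the first file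
of the node, `RestrictCutKernels`.  Namespace `…Theorems.HugValuationCut`; `--supports stmt-ResolutionOfSingularities-28338`.

## This file

§109 (g34 · NEW) THE CELLS OF THE CUT OF CELL D BY RING DIMENSION, BY NAME, AND THE HYPOTHESIS-FREE RE-LOCATIONS
(`section NonDivisorialCells`): D₃ = occult ∧ non-divisorial ∧ threefold — EMPTY in kernel
(`noWildOccultNonDivisorialThreefoldMixedTowers_holds`), D₄ = occult ∧ non-divisorial ∧ NON-threefold (ring
dimension ≥ 4 at some marked point; EXPECTED-HABITAT) — the letters of D verbatim ∧ `(¬)ThreefoldTower`; exact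
hypothesis-free re-locations D ⟺ D₄, C ∧ D ⟺ C ∧ D₄ =: **`NoWildOccultDivisorialOrNonThreefoldMixedTowers`** (THE
g34 LOCATED RESIDUAL — the route aside's HOME is this file, cone-free; `noWildOccultMixedTowers_iff_g34 :
NoWildOccultMixedTowers ↔ it`), R32 ⟺ B ∧ C ∧ D₄
(`noWildMixedWallFreeFreshJumpShallowCompanionKangarooTowers_iff_g34`); the profile (O2) is vacated.

[WRITER NOTE (decomp-res writer g12): file split only (tree files ≤ 400 lines); namespace, sections, section
variables / universes / opens and every declaration exactly as in the lens (the node's file-level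
dupNamespace-linter line is dropped — the library sets it; the `open …Theses` line lives only in the Theses-cone
file `MaxContactCutRestrictCut`); ONE dedup token change in `RestrictCutKernels`: the lens's 3-line folklore lemma
`stalkIdeal_bot_eq` restates the LANDED `TrackC.stalkIdeal_bot`
(`Theorems/WeightedInvariantLocalWeightedDropTrackCForward`, landed the same morning by another hand; pre-flight
`dedup.landed`) — the copy is DELETED, that module imported, and its one use in §107 cites `TrackC.stalkIdeal_bot`;
in THIS file the lens's last §109 corollary `noTowerWild_contactFreeOffLocus_nonDivisorial_threefold (hn) (P)` — a
statement-identical ALIAS of §108's `noTowerWild_nonDivisorial_threefold hn P` (landed in `RestrictCutKernels2`;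
proposal p816232 bounced `dedup.landed`) — is DELETED: cite `noTowerWild_nonDivisorial_threefold` for «the
non-divisorial threefold part of the whole tree aside is EMPTY in kernel for every class P»).]

(Sources: Hironaka1964 Ch. III; Giraud1975; Kollar2007 3.58–3.60; CossartJannsenSaito2020 Thm. 6.40, Ch. 8;
Hauser2010Kangaroo; HauserPerlega2019 §2; CossartPiltant2008 §2; deJong1996 (alterations); Hironaka2005 (numerical
exponent, three key theorems); EGAIV4 §16, §21 (divisors); Matsumura1987 §20 (UFD), §28; StacksProject 0804 / 0BIQ /
031I / 0AFT.)
-/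

noncomputable section

open CategoryTheory AlgebraicGeometry IsLocalRing TopologicalSpace
open Literature.AlgebraicGeometry.Resolution
open Summit.ResolutionOfSingularities.ResolutionOfSingularities.Theorems
open WeakOrderReduction ForcedTowerClasses DivergentTowerClasses MonomialTowerClasses
open HugDimensionClasses HugDimensionKernels SurfaceShadowClasses SurfaceShadowKernels
open NearPointCut (SingularClass)
open Scheme.IdealSheafData (vanishingIdeal)
open scoped BigOperators

namespace Summit.ResolutionOfSingularities.ResolutionOfSingularities.Theorems.HugValuationCut

section NonDivisorialCells

/-! ## ══ FILE 2/3 `Theorems/RestrictCutCells.lean` (§109; cone-free, imports FILE 1) ══ -/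

/-! ## §109 (g34 · NEW) THE CELLS OF THE CUT OF CELL D BY RING DIMENSION, BY NAME, AND THE HYPOTHESIS-FREE RE-LOCATIONS

CELL D (g33, `NoWildOccultNonDivisorialMixedTowers`) = D₃ ∧ D₄ exactly (excluded middle on `ThreefoldTower`); D₃
DECIDED (EMPTY IN
KERNEL, §108); D₄ UNDECIDED.  Re-locations, all HYPOTHESIS-FREE: D ⟺ D₄; the g33 occult residual
`NoWildOccultMixedTowers` (= C ∧ D)
⟺ C ∧ D₄ =: `NoWildOccultDivisorialOrNonThreefoldMixedTowers` (THE LOCATED RESIDUAL after g34); the g32 residual ⟺ B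
∧ C ∧ D₄; the
g31 residual likewise (g32's `…_iff_g32` is hypothesis-free). -/

/-- **CELL D₃ (occult non-divisorial ∧ THREEFOLD)** — DECIDED: EMPTY IN KERNEL (`noTower_nonDivisorial_threefold`).
ENTRANCE = the
letters-inhabitant (O2) `(x - 1)·(y³ + x³u², u⁴, yu³)` over `𝔽₃` of g33 §104 (ring dimension 3) — VACATED. -/
def WildOccultNonDivisorialThreefoldMixedWallFreeFreshJumpShallowCompanionKangarooTowersTerminate (n : ℕ) : Prop :=
  NoTowerWild n fun T => (((MixedResidual n T ∧ ¬ (LatentFactorTower T ∧ ThreefoldTower T)) ∧ ¬ LatentFactorTower T) ∧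
    ¬ DivisorialTower T) ∧ ThreefoldTower T

/-- **CELL D₄ (occult non-divisorial ∧ NON-THREEFOLD) · part of THE LOCATED RESIDUAL after g34 — «THE OCCULT
NON-DIVISORIAL TOWER OF RING
DIMENSION ≠ 3»** — UNDECIDED · honest tag EXPECTED-HABITAT rd 4 (inside the mixed residual the non-threefold towers are the
ring-dimension-4 column, beside CELL B), NO certified inhabitant on record: letters = all of CELL D's (g33) AND some
marked local ring is not
of dimension 3.  Law C and the restriction kernel do not bite (Law C is a ring-dimension-3 law). -/
def WildOccultNonDivisorialNonThreefoldMixedWallFreeFreshJumpShallowCompanionKangarooTowersTerminate (n : ℕ) : Prop :=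
  NoTowerWild n fun T => (((MixedResidual n T ∧ ¬ (LatentFactorTower T ∧ ThreefoldTower T)) ∧ ¬ LatentFactorTower T) ∧
    ¬ DivisorialTower T) ∧ ¬ ThreefoldTower T

/-- **EXACT (pure logic): CELL D = D₃ ∧ D₄.** [folklore] -/
theorem wildOccultNonDivisorialMixed_split (n : ℕ) :
    WildOccultNonDivisorialMixedWallFreeFreshJumpShallowCompanionKangarooTowersTerminate n ↔
      WildOccultNonDivisorialThreefoldMixedWallFreeFreshJumpShallowCompanionKangarooTowersTerminate n ∧
        WildOccultNonDivisorialNonThreefoldMixedWallFreeFreshJumpShallowCompanionKangarooTowersTerminate n :=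
  noTowerWild_split _ ThreefoldTower

/-- **CELL D₃ IS EMPTY (KERNEL, every `n ≥ 1`).** [folklore] -/
theorem wildOccultNonDivisorialThreefoldMixed_holds {n : ℕ} (hn : 1 ≤ n) :
    WildOccultNonDivisorialThreefoldMixedWallFreeFreshJumpShallowCompanionKangarooTowersTerminate n :=
  noTowerWild_mono (fun _ h => ⟨h.1.1, h.2, h.1.2⟩) (noTowerWild_nonDivisorial_threefold hn fun T =>
    (MixedResidual n T ∧ ¬ (LatentFactorTower T ∧ ThreefoldTower T)) ∧ ¬ LatentFactorTower T)

/-- **EXACT RE-LOCATION OF CELL D, HYPOTHESIS-FREE (every `n ≥ 1`): D ⟺ D₄.** [folklore] -/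
theorem wildOccultNonDivisorialMixed_iff_g34 {n : ℕ} (hn : 1 ≤ n) :
    WildOccultNonDivisorialMixedWallFreeFreshJumpShallowCompanionKangarooTowersTerminate n ↔
      WildOccultNonDivisorialNonThreefoldMixedWallFreeFreshJumpShallowCompanionKangarooTowersTerminate n :=
  (wildOccultNonDivisorialMixed_split n).trans ⟨fun h => h.2, fun h => ⟨wildOccultNonDivisorialThreefoldMixed_holds hn, h⟩⟩

/-- **EXACT RE-LOCATION OF THE g32 RESIDUAL, HYPOTHESIS-FREE (every `n ≥ 1`): `R32 ⟺ B ∧ C ∧ D₄`.** [folklore] -/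
theorem wildMixedWallFreeFreshJumpShallow_iff_g34 {n : ℕ} (hn : 1 ≤ n) :
    WildMixedWallFreeFreshJumpShallowCompanionKangarooTowersTerminate n ↔
      WildLatentFactorNonThreefoldMixedWallFreeFreshJumpShallowCompanionKangarooTowersTerminate n ∧
        (WildOccultDivisorialMixedWallFreeFreshJumpShallowCompanionKangarooTowersTerminate n ∧
          WildOccultNonDivisorialNonThreefoldMixedWallFreeFreshJumpShallowCompanionKangarooTowersTerminate n) :=
  (wildMixedWallFreeFreshJumpShallow_iff_g33 n).trans (Iff.and Iff.rfl (Iff.and Iff.rfl (wildOccultNonDivisorialMixed_iff_g34 hn)))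

/-- BY NAME: **no wild OCCULT NON-DIVISORIAL THREEFOLD mixed tower** (CELL D₃; DECIDED in kernel). -/
def NoWildOccultNonDivisorialThreefoldMixedTowers : Prop :=
  ∀ n : ℕ, 1 ≤ n → WildOccultNonDivisorialThreefoldMixedWallFreeFreshJumpShallowCompanionKangarooTowersTerminate n

/-- BY NAME: **no wild OCCULT NON-DIVISORIAL NON-THREEFOLD mixed tower** (CELL D₄; UNDECIDED · EXPECTED-HABITAT rd 4
— the occult
companion of CELL B in the ring-dimension-4 column). -/
def NoWildOccultNonDivisorialNonThreefoldMixedTowers : Prop :=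
  ∀ n : ℕ, 1 ≤ n → WildOccultNonDivisorialNonThreefoldMixedWallFreeFreshJumpShallowCompanionKangarooTowersTerminate n

/-- BY NAME: **THE LOCATED RESIDUAL of the lens-4 NP column after g34 — «no wild occult mixed tower that is DIVISORIAL or NOT A
THREEFOLD»** = CELL C ∧ CELL D₄ (C inhabited by (O1) `(y² + x³(x+u)²)·(y², u³, yu²)` over `𝔽₂`; D₄ expected in ring
dimension 4). -/
def NoWildOccultDivisorialOrNonThreefoldMixedTowers : Prop :=
  NoWildOccultDivisorialMixedTowers ∧ NoWildOccultNonDivisorialNonThreefoldMixedTowers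

/-- **CELL D₃ DECIDED BY NAME (kernel).** [folklore] -/
theorem noWildOccultNonDivisorialThreefoldMixedTowers_holds : NoWildOccultNonDivisorialThreefoldMixedTowers := fun _ hn =>
  wildOccultNonDivisorialThreefoldMixed_holds hn

/-- **EXACT RE-LOCATION BY NAME, HYPOTHESIS-FREE: CELL D ⟺ CELL D₄.** [folklore] -/
theorem noWildOccultNonDivisorialMixedTowers_iff_g34 :
    NoWildOccultNonDivisorialMixedTowers ↔ NoWildOccultNonDivisorialNonThreefoldMixedTowers :=
  ⟨fun h n hn => (wildOccultNonDivisorialMixed_iff_g34 hn).mp (h n hn),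
    fun h n hn => (wildOccultNonDivisorialMixed_iff_g34 hn).mpr (h n hn)⟩

/-- **EXACT RE-LOCATION BY NAME, HYPOTHESIS-FREE: the g33 occult residual `NoWildOccultMixedTowers` (= C ∧ D) ⟺ `C ∧
D₄` (the g34
located residual).** [folklore] -/
theorem noWildOccultMixedTowers_iff_g34 : NoWildOccultMixedTowers ↔ NoWildOccultDivisorialOrNonThreefoldMixedTowers :=
  Iff.and Iff.rfl noWildOccultNonDivisorialMixedTowers_iff_g34

/-- **EXACT RE-LOCATION BY NAME, HYPOTHESIS-FREE: the g32 residual ⟺ CELL B ∧ CELL C ∧ CELL D₄.** [folklore] -/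
theorem noWildMixedWallFreeFreshJumpShallowCompanionKangarooTowers_iff_g34 :
    NoWildMixedWallFreeFreshJumpShallowCompanionKangarooTowers ↔
      NoWildLatentFactorNonThreefoldMixedTowers ∧ NoWildOccultDivisorialMixedTowers ∧
        NoWildOccultNonDivisorialNonThreefoldMixedTowers :=
  noWildMixedWallFreeFreshJumpShallowCompanionKangarooTowers_iff_g33.trans
    (Iff.and Iff.rfl (Iff.and Iff.rfl noWildOccultNonDivisorialMixedTowers_iff_g34))

/-- **EXACT RE-LOCATION BY NAME, HYPOTHESIS-FREE: the g31 residual ⟺ CELL B ∧ CELL C ∧ CELL D₄** (g32's re-location of the g31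
residual is hypothesis-free). [folklore] -/
theorem noWildNonSurfaceWallFreeFreshJumpShallowCompanionKangarooTowers_iff_g34 :
    NoWildNonSurfaceWallFreeFreshJumpShallowCompanionKangarooTowers ↔
      NoWildLatentFactorNonThreefoldMixedTowers ∧ NoWildOccultDivisorialMixedTowers ∧
        NoWildOccultNonDivisorialNonThreefoldMixedTowers :=
  noWildNonSurfaceWallFreeFreshJumpShallowCompanionKangarooTowers_iff_g32.trans
    noWildMixedWallFreeFreshJumpShallowCompanionKangarooTowers_iff_g34

/-- up-link (hypothesis-free): CELL D₄ ⟸ CELL D. [folklore] -/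
theorem noWildOccultNonDivisorialNonThreefoldMixedTowers_of_g33 (h : NoWildOccultNonDivisorialMixedTowers) :
    NoWildOccultNonDivisorialNonThreefoldMixedTowers :=
  noWildOccultNonDivisorialMixedTowers_iff_g34.mp h

/-- up-link (hypothesis-free): the g34 located residual ⟸ the g32 residual. [folklore] -/
theorem noWildOccultDivisorialOrNonThreefoldMixedTowers_of_g32 (h : NoWildMixedWallFreeFreshJumpShallowCompanionKangarooTowers) :
    NoWildOccultDivisorialOrNonThreefoldMixedTowers :=
  (noWildMixedWallFreeFreshJumpShallowCompanionKangarooTowers_iff_g34.mp h).2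

/-- up-link from the TREE aside `NoWildContactFreeOffLocusTowers` (hypothesis-free). [folklore] -/
theorem noWildOccultDivisorialOrNonThreefoldMixedTowers_of_aside (h : NoWildContactFreeOffLocusTowers) :
    NoWildOccultDivisorialOrNonThreefoldMixedTowers :=
  noWildOccultMixedTowers_iff_g34.mp (noWildOccultMixedTowers_of_aside h)

end NonDivisorialCells

end Summit.ResolutionOfSingularities.ResolutionOfSingularities.Theorems.HugValuationCut
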